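import Summits.QuantumFields.BalabanUV.T4Continuum.Support.NE7AllMinimisersHolderRegGeneric
import HarnessLib

/-!
# NE7AllMinimisersAxialPotentialGeneric — THE SHARP (LOG-FORM) AXIAL-GAUGE POTENTIAL LETTER OF EVERY CONSTRAINED SMALL-FIELD MINIMISER, `d = 4`, any `L ≥ 2`, any `U(n)`:
# `∃ c ≥ 0, ∃ ε₀ > 0, ∀ 0 < ε ≤ ε₀, ∀ N ≥ 1, ∃ δ_V > 0`, for every datum of the small data, every level `k` (`M = L^k`), every minimiser `U` at level `k`, every base point `y` and
# every `x` with `y ≤ x`, `l1(x − y) ≤ 100`: in the complete axial gauge `V₀ = U^{v₀}` based at `y`, with `B = log V₀`,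
#   `U = (v₀⁻¹·expUnit B·v₀)` at `(x, κ)`,   `‖B(x,κ)‖ ≤ cε∕M²`,   `‖Δ_ι B(x,κ)‖ ≤ cε∕M²`,   `‖Δ_ιΔ_ι′ B(x,κ)‖ ≤ c·ε·(1+k)∕M³`
# — the β-FREE statement behind gen 111's (9)-TYPE theorem ✓ p814290: the second differences of the potential carry EXACTLY the logarithm `(1+k) = log_L M + 1` of the
# (10)-log (and no worse); `HolderReg` at any `β < 1` is its corollary through `(1+k)L^{−k(1−β)} ≤ (1 − L^{β−1})⁻¹`

Cell `pub-balaban`, rung (B)+1 sub-cell t4, lineage `b2b-balaban-t4-ne7-p1` (CRUX PROVER NE7 #1 = OWNER of BINDER row NE7), generation 111.  Memo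
`t4/b2b-balaban-t4-ne7-p1-g111/ROAD-G111.md` §9.  File F9 of the (9)-type line; over ✓ p813980∕p814155 (`axial_rep`, `norm_axialLog_le`, `norm_axialLog_diff_le`,
`norm_axialLog_secondDiff_le`), ✓ p814206 `M2_le`, ✓ p814290 `all_minimisers_classData_explicit`.
WHAT ([folklore]; 0 def, 0 sorry).  **`all_minimisers_axialPotential_generic`** (displayed above; `c = max(8(200C + 20001), K₁(C)(2C + 202) + 6464C + 653024)`, `C` the (10)-log constant).
HONEST FRAMING (page 1): OUR minimisers, OUR route; the `(1+k)` is NOT removable on this route (junction logarithm, kit j342950); region `l1(x − y) ≤ 100` about any base point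
(lattice-local); nothing of Bałaban's asserted; NE3∕NE7 NOT proved as spine nodes; spine 0∕9; FIXED FINITE T⁴ rung (B)+1 — NOT infinite volume, NOT mass gap, NOT BetaPertH, NOT Clay.
-/

set_option autoImplicit false

open scoped BigOperators Matrix Matrix.Norms.L2Operator
open NormedSpace Finset

namespace Summit.QuantumFields.BalabanUV.T4Continuum.NE7AllMinimisersAxialPotentialGeneric

open Literature.MathematicalPhysics.QuantumFieldTheory.Balaban1983to89
open B7Prop1Explicit B7Prop2Explicit MatrixLog
open T4AveragingDeficitWall (IsUnitaryCfg SmallField)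
open T4AveragingDeficitWallBoundary (IsPeriodicCfg)
open MinimalActionSandwich (IsMinimiser)
open MinimalActionRate (sfClass)
open NE7AxialGaugePotential (axial_rep norm_axialLog_le norm_axialLog_diff_le)
open NE7AxialGaugePotentialHolder (norm_axialLog_secondDiff_le)
open NE7HolderConstantsArith (M2_le)
open NE7AllMinimisersHolderRegGeneric (all_minimisers_classData_explicit)

noncomputable section

variable {n : Type} [Fintype n] [DecidableEq n]

set_option maxHeartbeats 800000 in
/-- **THE SHARP AXIAL-GAUGE POTENTIAL LETTER OF EVERY CONSTRAINED MINIMISER** (statement in the file header). [folklore] -/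
theorem all_minimisers_axialPotential_generic [Nonempty n] {L : ℕ} (hL : 2 ≤ L) :
    ∃ c : ℝ, 0 ≤ c ∧ ∃ ε₀ : ℝ, 0 < ε₀ ∧ ∀ ε : ℝ, 0 < ε → ε ≤ ε₀ → ∀ (N : ℕ) [NeZero N], 1 ≤ N →
      ∃ δV : ℝ, 0 < δV ∧
        ∀ V ∈ {V : Site 4 → Fin 4 → (Matrix n n ℂ)ˣ | IsUnitaryCfg V ∧ IsPeriodicCfg V (N : ℤ) ∧ SmallField V δV},
        ∀ (k : ℕ) (U : Site 4 → Fin 4 → (Matrix n n ℂ)ˣ), IsMinimiser 4 (sfClass 4 L N ε) L N k V U →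
          ∀ (y x : Site 4), y ≤ x → l1 (x - y) ≤ 100 → ∀ κ ι ι' : Fin 4,
            U x κ = gaugeAct (fun z => (axialFn U y z)⁻¹)
              (fun z j => expUnit (mlog ((gaugeAct (axialFn U y) U z j : (Matrix n n ℂ)ˣ) : Matrix n n ℂ))) x κ ∧
            ‖mlog ((gaugeAct (axialFn U y) U x κ : (Matrix n n ℂ)ˣ) : Matrix n n ℂ)‖ ≤ c * ε / ((L : ℝ) ^ k) ^ 2 ∧
            ‖mlog ((gaugeAct (axialFn U y) U (x + e ι) κ : (Matrix n n ℂ)ˣ) : Matrix n n ℂ)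
                - mlog ((gaugeAct (axialFn U y) U x κ : (Matrix n n ℂ)ˣ) : Matrix n n ℂ)‖ ≤ c * ε / ((L : ℝ) ^ k) ^ 2 ∧
            ‖mlog ((gaugeAct (axialFn U y) U (x + e ι + e ι') κ : (Matrix n n ℂ)ˣ) : Matrix n n ℂ)
                - mlog ((gaugeAct (axialFn U y) U (x + e ι) κ : (Matrix n n ℂ)ˣ) : Matrix n n ℂ)
                - mlog ((gaugeAct (axialFn U y) U (x + e ι') κ : (Matrix n n ℂ)ˣ) : Matrix n n ℂ)
                + mlog ((gaugeAct (axialFn U y) U x κ : (Matrix n n ℂ)ˣ) : Matrix n n ℂ)‖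
              ≤ c * ε * (1 + (k : ℝ)) / ((L : ℝ) ^ k) ^ 3 := by
  obtain ⟨C, hC, ε₁, hε₁, H⟩ := all_minimisers_classData_explicit (n := n) hL
  have hLr : (1 : ℝ) < L := by exact_mod_cast (lt_of_lt_of_le (by norm_num) hL)
  set K₁ : ℝ := (8 * (201 + 200 * (4 * (101 * (2 * C + 202) + 1))) + 8 * 404 ^ 2 * (2 * C + 202)) with hK₁
  have hK₁0 : 0 ≤ K₁ := by positivity
  refine ⟨max (8 * (200 * C + 20001)) (K₁ * (2 * C + 202) + 6464 * C + 653024), le_max_of_le_left (by positivity),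
    min ε₁ (1 / 206), lt_min hε₁ (by norm_num), ?_⟩
  intro ε hε hεle N _ hN
  have hεε₁ : ε ≤ ε₁ := hεle.trans (min_le_left _ _)
  have hε206 : ε ≤ 1 / 206 := hεle.trans (min_le_right _ _)
  have hε1 : ε ≤ 1 := hε206.trans (by norm_num)
  obtain ⟨δV, hδV, HV⟩ := H ε hε hεε₁ N hN
  refine ⟨δV, hδV, ?_⟩
  intro V hV k U hmin y x hyx hxR κ ι ι'
  obtain ⟨hUu, hUs, hUg⟩ := HV V hV k U hmin
  set M : ℝ := (L : ℝ) ^ k with hMdef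
  have hM1 : 1 ≤ M := one_le_pow₀ hLr.le
  have hM0 : 0 < M := by linarith
  have hkkM : 1 + (k : ℝ) ≤ M := by
    have h1 : k + 1 ≤ 2 ^ k := Nat.lt_two_pow_self
    have h2 : 2 ^ k ≤ L ^ k := Nat.pow_le_pow_left hL k
    have h3 : ((k + 1 : ℕ) : ℝ) ≤ ((L ^ k : ℕ) : ℝ) := by exact_mod_cast h1.trans h2
    rw [hMdef]; push_cast at h3 ⊢; linarith
  -- the letters `a = ε/M²`, `b = Cε(1+k)/M³`
  set a : ℝ := ε / M ^ 2 with ha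
  set b : ℝ := C * ε * (1 + (k : ℝ)) / M ^ 3 with hb
  have ha0 : 0 ≤ a := by positivity
  have hb0 : 0 ≤ b := by positivity
  have haε : a ≤ ε := by rw [ha]; exact div_le_self hε.le (one_le_pow₀ hM1)
  have ha1 : a ≤ 1 := haε.trans hε1
  have ha4 : a ≤ 1 / 4 := haε.trans (hε206.trans (by norm_num))
  have h103 : ((100 + 3 : ℕ) : ℝ) * a ≤ 1 / 2 := by
    have e : ((100 + 3 : ℕ) : ℝ) = 103 := by norm_num
    rw [e]; linarith
  have h101 : ((100 + 1 : ℕ) : ℝ) * a ≤ 1 / 2 := by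
    have e : ((100 + 1 : ℕ) : ℝ) = 101 := by norm_num
    rw [e]; linarith
  have hxa : (l1 (x - y) : ℝ) * a ≤ 100 * a := mul_le_mul_of_nonneg_right (by exact_mod_cast hxR) ha0
  -- `u := ε(1+k)/M³` dominates `b/C`, `a²`, `ab`
  set u : ℝ := ε * (1 + (k : ℝ)) / M ^ 3 with hu
  have hu0 : 0 ≤ u := by positivity
  have hbu : b = C * u := by rw [hb, hu]; ring
  have hkM : (1 + (k : ℝ)) / M ≤ 1 := by rw [div_le_one hM0]; exact hkkM
  have hau : a ≤ ε / M ^ 2 := le_rfl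
  have ha2u : a * a ≤ u := by
    -- `a² = ε²/M⁴ = (ε/M)·(ε/M³) ≤ ε(1+k)/M³`
    rw [ha, hu]
    have e : ε / M ^ 2 * (ε / M ^ 2) = (ε / M) * (ε * 1 / M ^ 3) := by field_simp
    rw [e]
    have h1 : ε / M ≤ 1 := (div_le_self hε.le hM1).trans hε1
    have h2 : ε * 1 / M ^ 3 ≤ ε * (1 + (k : ℝ)) / M ^ 3 :=
      div_le_div_of_nonneg_right (by nlinarith) (by positivity)
    calc ε / M * (ε * 1 / M ^ 3) ≤ 1 * (ε * 1 / M ^ 3) := mul_le_mul_of_nonneg_right h1 (by positivity)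
      _ ≤ ε * (1 + (k : ℝ)) / M ^ 3 := by rw [one_mul]; exact h2
  have habu : a * b ≤ C * u := by
    rw [hbu]
    calc a * (C * u) ≤ 1 * (C * u) := mul_le_mul_of_nonneg_right ha1 (by positivity)
      _ = C * u := one_mul _
  have hau2 : a ≤ a := le_rfl
  have hεM2 : ε / M ^ 2 = a := rfl
  refine ⟨?_, ?_, ?_, ?_⟩
  · -- representation
    refine axial_rep hUu ha0 hUs hyx κ ?_
    linarith
  · -- size: `‖B‖ ≤ 2·l1·a ≤ 200a = 200ε/M²`
    have h := norm_axialLog_le hUu ha0 hUs hyx κ (hxa.trans (by linarith))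
    have hc : (200 : ℝ) * ε / M ^ 2 ≤ max (8 * (200 * C + 20001)) (K₁ * (2 * C + 202) + 6464 * C + 653024) * ε / M ^ 2 := by
      refine div_le_div_of_nonneg_right (mul_le_mul_of_nonneg_right ?_ hε.le) (by positivity)
      exact le_max_of_le_left (by nlinarith)
    refine le_trans ?_ hc
    calc _ ≤ 2 * ((l1 (x - y) : ℝ) * a) := h
      _ ≤ 2 * (100 * a) := by linarith
      _ = 200 * ε / M ^ 2 := by rw [ha]; ring
  · -- first differences: `≤ 8(100(2b + 2(100a)a) + a) ≤ 8(200C + 20001)·ε/M²`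
    have h := norm_axialLog_diff_le hUu hUs ha0 ha4 hb0 hUg y 100 h101 hyx hxR κ ι
    have hbε : b ≤ C * (ε / M ^ 2) := by
      rw [hb]
      have e : C * ε * (1 + (k : ℝ)) / M ^ 3 = C * (ε / M ^ 2) * ((1 + (k : ℝ)) / M) := by field_simp
      rw [e]
      calc C * (ε / M ^ 2) * ((1 + (k : ℝ)) / M) ≤ C * (ε / M ^ 2) * 1 := mul_le_mul_of_nonneg_left hkM (by positivity)
        _ = C * (ε / M ^ 2) := mul_one _
    have haa : (100 : ℝ) * a * a ≤ 100 * (ε / M ^ 2) := by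
      rw [← hεM2]; nlinarith
    have hc : 8 * (200 * C + 20001) * ε / M ^ 2 ≤ max (8 * (200 * C + 20001)) (K₁ * (2 * C + 202) + 6464 * C + 653024) * ε / M ^ 2 :=
      div_le_div_of_nonneg_right (mul_le_mul_of_nonneg_right (le_max_left _ _) hε.le) (by positivity)
    refine le_trans ?_ hc
    calc _ ≤ 2 * (((4 : ℕ) : ℝ) * ((100 : ℕ) * (2 * b + 2 * (((100 : ℕ) : ℝ) * a) * a) + a)) := h
      _ = 8 * (200 * b + 200 * (100 * a * a) + a) := by push_cast; ring
      _ ≤ 8 * (200 * (C * (ε / M ^ 2)) + 200 * (100 * (ε / M ^ 2)) + ε / M ^ 2) := by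
          have h1 : a ≤ ε / M ^ 2 := hεM2.ge
          nlinarith [hbε, haa, h1]
      _ = 8 * (200 * C + 20001) * ε / M ^ 2 := by ring
  · -- second differences: `≤ K₁p₁ + 6464ab + 653024a² ≤ (K₁(2C+202) + 6464C + 653024)·u`
    have h := norm_axialLog_secondDiff_le hUu hUs ha0 ha4 hb0 hUg y 100 h103 hyx hxR κ ι ι'
    have hbC : b ≤ C := by
      rw [hbu]
      have hu1 : u ≤ 1 := by
        rw [hu, div_le_one (by positivity)]
        calc ε * (1 + (k : ℝ)) ≤ 1 * M := mul_le_mul hε1 hkkM (by positivity) (by norm_num)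
          _ ≤ M ^ 3 := by nlinarith
      nlinarith
    have hM2 := M2_le ha0 ha1 hb0 hbC
    have hc : (K₁ * (2 * C + 202) + 6464 * C + 653024) * ε * (1 + (k : ℝ)) / M ^ 3
        ≤ max (8 * (200 * C + 20001)) (K₁ * (2 * C + 202) + 6464 * C + 653024) * ε * (1 + (k : ℝ)) / M ^ 3 :=
      div_le_div_of_nonneg_right (mul_le_mul_of_nonneg_right (mul_le_mul_of_nonneg_right (le_max_right _ _) hε.le) (by positivity))
        (by positivity)
    refine le_trans ?_ hc
    have e0 : (K₁ * (2 * C + 202) + 6464 * C + 653024) * ε * (1 + (k : ℝ)) / M ^ 3 = (K₁ * (2 * C + 202) + 6464 * C + 653024) * u := by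
      rw [hu]; ring
    rw [e0]
    calc _ ≤ 2 * (((4 : ℕ) : ℝ) * ((100 : ℕ) * (2 * (2 * b + 2 * (((100 + 1 : ℕ) : ℝ) * a) * a)
              + 2 * (2 * b + 2 * (((100 + 1 : ℕ) : ℝ) * a) * a) * (((4 : ℕ) : ℝ) * ((100 + 1 : ℕ) * (2 * b + 2 * (((100 + 1 : ℕ) : ℝ) * a) * a) + a)))
            + ((2 * b + 2 * (((100 + 1 : ℕ) : ℝ) * a) * a) + a * (((4 : ℕ) : ℝ) * ((100 + 1 : ℕ) * (2 * b + 2 * (((100 + 1 : ℕ) : ℝ) * a) * a) + a)))))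
          + 4 * (((4 : ℕ) : ℝ) * ((100 + 1 : ℕ) * (2 * b + 2 * (((100 + 1 : ℕ) : ℝ) * a) * a) + a)) ^ 2 := h
      _ = 2 * (4 * (100 * (2 * (2 * b + 2 * (101 * a) * a) + 2 * (2 * b + 2 * (101 * a) * a) * (4 * (101 * (2 * b + 2 * (101 * a) * a) + a)))
            + ((2 * b + 2 * (101 * a) * a) + a * (4 * (101 * (2 * b + 2 * (101 * a) * a) + a)))))
          + 4 * (4 * (101 * (2 * b + 2 * (101 * a) * a) + a)) ^ 2 := by push_cast; ring
      _ ≤ K₁ * (2 * b + 2 * (101 * a) * a) + 6464 * (a * b) + 653024 * a ^ 2 := by rw [hK₁]; exact hM2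
      _ ≤ K₁ * (2 * (C * u) + 2 * (101 * u)) + 6464 * (C * u) + 653024 * u := by
          have h1 : 2 * (101 * a) * a ≤ 2 * (101 * u) := by nlinarith
          have h2 : a ^ 2 ≤ u := by rw [sq]; exact ha2u
          have h3 : 2 * b ≤ 2 * (C * u) := by rw [hbu]
          nlinarith [mul_le_mul_of_nonneg_left (add_le_add h3 h1) hK₁0]
      _ = (K₁ * (2 * C + 202) + 6464 * C + 653024) * u := by ring

end

end Summit.QuantumFields.BalabanUV.T4Continuum.NE7AllMinimisersAxialPotentialGeneric
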